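import Summits.QuantumFields.YangMills.Theses.ParabolicTrajectory
import Summits.QuantumFields.YangMills.Theorems.TunedSequenceExists.Negative.AtZeroFalse

/-!
# `TunedSequenceExists` — negative lemma: uniform weak-coupling clustering kills the window;
# the crux implies `ξ(β) → ∞` (no uniform clustering) for every compact simple `G`

Crux `Summit.QuantumFields.YangMills.Theses.ParabolicTrajectory.TunedSequenceExists` (item
stmt-QuantumFields-10524; cdisprove gen 3, importable extract of § Clustering of the crux workfile
`Summits/QuantumFields/YangMills/Cruxes/TunedSequenceExists/Disproof.lean`).

* `weak_false_of_uniformClustering` — if for some `β₁`, `m > 0`, `C` the finite-torus curvature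
  correlator obeys `|⟨P ; τ_D P⟩_{β, 2L+1}| ≤ C e^{-m D}` for ALL `β ≥ β₁`, all `L`, all `D ≤ L`
  (lattice-units mass gap and amplitude uniform at weak coupling), then even the WEAK crux body
  (shape, `β_k → ∞`, tuning `N_1(k) → θ`; clause (iii) dropped) is false at that `(G, r)` for every
  `M`: `|N_1(k)| ≤ C (M^{n_k})^8 e^{-m M^{n_k}} → 0`;
* `window_false_of_uniformClustering` — the crux body verbatim dies as well;
* `not_uniformClustering_of_tunedSequenceExists` — hence the crux implies that NO compact simple
  lattice gauge theory (Wilson action in any faithful unitary `r`) clusters uniformly on any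
  `[β₁, ∞)`: the lattice correlation length is unbounded as `β → ∞` (a weak, finite-volume form of
  Chatterjee arXiv:1803.01950 Problem 5.1, open for every 4-d non-abelian `G`). This is the honest
  negation target of (S) — a disproof of the crux for one datum IS such a uniform clustering bound —
  and the formal shape of the finite-group obstruction (`DiscreteSubgroupFreezing`: volume-uniform
  low-temperature expansions with `β`-independent rate), i.e. why `ConnectedSpace G` inside
  `IsSimpleCompactGroup` is load-bearing. Gen 1 had the fixed-coupling instance (`β_k ≡ β`).
-/

noncomputable section

open Filter Topology MeasureTheory
open Literature.MathematicalPhysics.QuantumFieldTheory Literature.MathematicalPhysics.QuantumLattice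
open Summit.QuantumFields.YangMills.Theorems.TunedSequenceExists.Negative.AtZeroFalse
  (tendsto_pow_of_shape eventually_sep_le_L)

namespace Summit.QuantumFields.YangMills.Theorems.TunedSequenceExists.Negative.UniformClustering

section Clustering

variable {G : Type} [Group G] [TopologicalSpace G] [IsTopologicalGroup G] [CompactSpace G]
  [MeasurableSpace G] [BorelSpace G]

omit [Group G] [TopologicalSpace G] [IsTopologicalGroup G] [CompactSpace G] [MeasurableSpace G]
  [BorelSpace G] in
/-- `x^p · C e^{-m x} → 0` as `x → ∞` (`m > 0`). -/
theorem tendsto_pow_mul_const_mul_exp_neg (p : ℕ) {m : ℝ} (hm : 0 < m) (C : ℝ) :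
    Tendsto (fun x : ℝ => x ^ p * (C * Real.exp (-(m * x)))) atTop (𝓝 0) := by
  have h := (Real.tendsto_pow_mul_exp_neg_atTop_nhds_zero p).comp (tendsto_id.const_mul_atTop hm)
  have h2 := h.const_mul (C * (m ^ p)⁻¹)
  rw [mul_zero] at h2
  refine h2.congr fun x => ?_
  have hmp : (m ^ p)⁻¹ * m ^ p = 1 := inv_mul_cancel₀ (pow_ne_zero _ hm.ne')
  simp only [Function.comp_apply, id, mul_pow]
  calc C * (m ^ p)⁻¹ * (m ^ p * x ^ p * Real.exp (-(m * x)))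
      = ((m ^ p)⁻¹ * m ^ p) * (x ^ p * (C * Real.exp (-(m * x)))) := by ring
    _ = x ^ p * (C * Real.exp (-(m * x))) := by rw [hmp, one_mul]

/-- **Uniform weak-coupling exponential clustering kills the (weak) crux body.** If for some
`β₁`, `m > 0`, `C` the finite-torus curvature correlator obeys `|⟨P ; τ_D P⟩_{β, 2L+1}| ≤ C e^{-m D}`
for ALL `β ≥ β₁`, all `L` and all `D ≤ L` (a lattice-units mass gap bounded below uniformly at weak
coupling), then no `M`-adic tuned sequence with `β_k → ∞` exists (`M ≥ 2`): `|N_1(k)| ≤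
C (M^{n_k})^8 e^{-m M^{n_k}} → 0`. Contrapositive: the crux body implies that the lattice correlation
length (in lattice units) is NOT bounded uniformly on any `[β₁, ∞)` — a form of `ξ(β) → ∞`. -/
theorem weak_false_of_uniformClustering (r : LatticeRep G) {M : ℕ} {β₁ m C : ℝ} (hm : 0 < m)
    (hcl : ∀ β : ℝ, β₁ ≤ β → ∀ L D : ℕ, D ≤ L →
      |latticeConnectedCorr r.ρ β (2 * L + 1) r.curvature.F r.curvature.F D| ≤
        C * Real.exp (-(m * D))) :
    ¬ (∃ θ₀ : ℝ, 0 < θ₀ ∧ ∀ θ : ℝ, 0 < θ → θ < θ₀ →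
      ∃ (sch : SpeciesScheme (YMSpecies G)) (n : ℕ → ℕ),
        (∀ k, sch.a k = ((M : ℝ) ^ n k)⁻¹) ∧ Tendsto sch.β atTop atTop ∧
        Tendsto (fun k => ((M : ℝ) ^ n k) ^ 8 *
            latticeConnectedCorr r.ρ (sch.β k) (sch.side k) r.curvature.F r.curvature.F
              (M ^ n k)) atTop (𝓝 θ)) := by
  rintro ⟨θ₀, hθ₀, h⟩
  obtain ⟨sch, n, hshape, hβ, hlim⟩ := h (θ₀ / 2) (by positivity) (by linarith)
  have hu : Tendsto (fun k => ((M : ℝ) ^ n k) ^ 8 * (C * Real.exp (-(m * (M : ℝ) ^ n k))))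
      atTop (𝓝 0) :=
    (tendsto_pow_mul_const_mul_exp_neg 8 hm C).comp (tendsto_pow_of_shape sch hshape)
  have hev1 : ∀ᶠ k in atTop, β₁ ≤ sch.β k := tendsto_atTop.1 hβ β₁
  have hev2 : ∀ᶠ k in atTop, 1 * M ^ n k ≤ sch.L k := eventually_sep_le_L sch hshape 1
  have hθ4 : (0 : ℝ) < θ₀ / 4 := by positivity
  have hev3 : ∀ᶠ k in atTop,
      ((M : ℝ) ^ n k) ^ 8 * (C * Real.exp (-(m * (M : ℝ) ^ n k))) < θ₀ / 4 :=
    hu.eventually (gt_mem_nhds hθ4)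
  have hθ42 : θ₀ / 4 < θ₀ / 2 := by linarith
  have hev4 : ∀ᶠ k in atTop, θ₀ / 4 < ((M : ℝ) ^ n k) ^ 8 *
      latticeConnectedCorr r.ρ (sch.β k) (sch.side k) r.curvature.F r.curvature.F (M ^ n k) :=
    hlim.eventually (lt_mem_nhds hθ42)
  obtain ⟨k, hk1, hk2, hk3, hk4⟩ := (hev1.and (hev2.and (hev3.and hev4))).exists
  have hside : sch.side k = 2 * sch.L k + 1 := rfl
  have hb := hcl (sch.β k) hk1 (sch.L k) (M ^ n k) (by simpa using hk2)
  have hb' : |latticeConnectedCorr r.ρ (sch.β k) (sch.side k) r.curvature.F r.curvature.F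
      (M ^ n k)| ≤ C * Real.exp (-(m * (M : ℝ) ^ n k)) := by
    simpa [Nat.cast_pow, hside] using hb
  have hpow : (0 : ℝ) ≤ ((M : ℝ) ^ n k) ^ 8 := by positivity
  have hle : ((M : ℝ) ^ n k) ^ 8 *
      latticeConnectedCorr r.ρ (sch.β k) (sch.side k) r.curvature.F r.curvature.F (M ^ n k) ≤
      ((M : ℝ) ^ n k) ^ 8 * (C * Real.exp (-(m * (M : ℝ) ^ n k))) :=
    mul_le_mul_of_nonneg_left ((le_abs_self _).trans hb') hpow
  linarith

/-- The same with clause (iii) present (the crux body verbatim at fixed `(G, r, M)`). -/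
theorem window_false_of_uniformClustering (r : LatticeRep G) {M : ℕ} {β₁ m C : ℝ} (hm : 0 < m)
    (hcl : ∀ β : ℝ, β₁ ≤ β → ∀ L D : ℕ, D ≤ L →
      |latticeConnectedCorr r.ρ β (2 * L + 1) r.curvature.F r.curvature.F D| ≤
        C * Real.exp (-(m * D))) :
    ¬ (∃ θ₀ : ℝ, 0 < θ₀ ∧ ∀ θ : ℝ, 0 < θ → θ < θ₀ →
      ∃ (sch : SpeciesScheme (YMSpecies G)) (n : ℕ → ℕ),
        (∀ k, sch.a k = ((M : ℝ) ^ n k)⁻¹) ∧ Tendsto sch.β atTop atTop ∧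
        (∀ t : ℕ, 0 < t → ∃ c : ℝ, Tendsto (fun k => ((M : ℝ) ^ n k) ^ 8 *
            latticeConnectedCorr r.ρ (sch.β k) (sch.side k) r.curvature.F r.curvature.F
              (t * M ^ n k)) atTop (𝓝 c)) ∧
        Tendsto (fun k => ((M : ℝ) ^ n k) ^ 8 *
            latticeConnectedCorr r.ρ (sch.β k) (sch.side k) r.curvature.F r.curvature.F
              (M ^ n k)) atTop (𝓝 θ)) := by
  rintro ⟨θ₀, hθ₀, h⟩
  refine weak_false_of_uniformClustering r (M := M) hm hcl ⟨θ₀, hθ₀, fun θ h1 h2 => ?_⟩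
  obtain ⟨sch, n, hshape, hβ, -, hlim⟩ := h θ h1 h2
  exact ⟨sch, n, hshape, hβ, hlim⟩

/-- **The crux implies the absence of uniform weak-coupling clustering** for EVERY compact simple
`G` and every faithful unitary `r`: along `β → ∞` the lattice-units clustering rate of the curvature
correlator cannot stay bounded below with a uniform constant (a weak `ξ(β) → ∞`, cf. Chatterjee,
arXiv:1803.01950, Problem 5.1). Equivalently: a volume-uniform low-temperature (large-`β`)
expansion with a `β`-independent decay rate for ONE compact simple `G` would refute the crux — which
is exactly how the window fails for FINITE gauge groups (barrier `DiscreteSubgroupFreezing`), and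
why connectedness inside `IsCompactSimpleLieGroup` is load-bearing. -/
theorem not_uniformClustering_of_tunedSequenceExists
    (h : Summit.QuantumFields.YangMills.Theses.ParabolicTrajectory.TunedSequenceExists)
    (G : Type) [Group G] [TopologicalSpace G] [IsTopologicalGroup G] [CompactSpace G]
    (hG : IsCompactSimpleLieGroup G) :
    letI : MeasurableSpace G := borel G
    haveI : BorelSpace G := ⟨rfl⟩
    ∀ r : LatticeRep G, ¬ ∃ (β₁ m C : ℝ), 0 < m ∧ ∀ β : ℝ, β₁ ≤ β → ∀ L D : ℕ, D ≤ L →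
      |latticeConnectedCorr r.ρ β (2 * L + 1) r.curvature.F r.curvature.F D| ≤
        C * Real.exp (-(m * D)) := by
  letI : MeasurableSpace G := borel G
  haveI : BorelSpace G := ⟨rfl⟩
  intro r ⟨β₁, m, C, hm, hcl⟩
  exact window_false_of_uniformClustering r (M := 2) hm hcl (h G hG r 2 le_rfl)

end Clustering

end Summit.QuantumFields.YangMills.Theorems.TunedSequenceExists.Negative.UniformClustering

end
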